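import Mathlib
import HarnessLib
import Summits.HubbardSuperconductivity.HubbardSuperconductivity.Theorems.KLProgrammeH10TwoPointLimitPerturbedCountCover
import Summits.HubbardSuperconductivity.HubbardSuperconductivity.Theorems.KLProgrammeH10TwoPointLimitPerturbedCountSymmetry
import Summits.HubbardSuperconductivity.HubbardSuperconductivity.Theorems.KLProgrammePerturbedCountConstantsDefs

/-!
# Route `KLProgramme` — K3 engine child `KLRegimeEngineV17F2` (stmt-HubbardSuperconductivity-20437), stub (b) import ι₂:
# ALIGNED RIGIDITY and the ALIGNMENT DICHOTOMY on the perturbed curve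

Cell gate-hubbard-kl, plan g17 (R41)(i) «E1-P2-THIN-COUNT» (seat p4; plan HOME/prover-p4/E1-P2-THIN-COUNT-PLAN.md §Refinement 4, part (F3d)
perturbed twin).  Twin of `BandSectorCounting.abs_alignment_ge` / `aligned_rigidity` (`ThinSectorFoldAlignedRigidity`) for the perturbed level function
`h^E_P` (`KLProgrammePerturbedCountDefs`): on the diagonal `σ ↦ (σ, σ)` the momentum sum is `S₀ = P + 2p_E(σ)`; if the diagonal value
`|h^E_P(σ,σ)| ≤ η₀` and the perturbed diagonal partial `|∂₃h^E_P(σ,σ)| ≤ η₁` are small then the alignment functional of the frozen sines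
`I = sin S_x·sin X_E(σ) + sin S_y·sin Y_E(σ)` satisfies `|I| ≥ ρ_min² − 2e₃` (the dichotomy, any offset `P`), and if moreover `I > 0` (ALIGNED) and
the offset is the anchor ON the curve, `P = p_E(θ₁)`, then for an EVEN perturbation (centrally symmetric curve, `curve_add_pi`)
`|sin((σ − θ₁ − π)/2)| ≤ π·e₃/(√2·u_min)` — the aligned near-critical near-zero diagonal configuration IS the forward point `σ ≡ θ₁ + π`.
Here `e₃ = η₀/Dt_min + 2κ₀/Dt_min + s_max·C_g·ε₄(η₁, η₀/Dt_min)` with `ε₄` the covering tolerance `pcE4` (the shifted-level trick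
`X_E(σ) = bandX ν_σ σ`, `exists_int_near_of_h3E_small`, `exists_sign_align` at the level `ν_σ`); the umklapp margin reads `π e₃ + 2K(b) < 2π`
(every coordinate of the perturbed curve is `≤ K(ν) ≤ K(b)` in modulus, `umklappRadius_mono`).

* `chord_lower_perturbed` — `4u_min² sin²((θ − θ′)/2) ≤ |p_E(θ) − p_E(θ′)|²`;
* `abs_XE_le_umklappRadius` — `|X_E θ|, |Y_E θ| ≤ K(b)`;
* `abs_alignment_ge_perturbed`, `aligned_rigidity_perturbed`.

Everything is PROVED; no definitions.  References: BGM 2006 Lemma 3.1 / App. A2, Remark after (2.39) [cite: BenfattoGiulianiMastropietro2006];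
Mastropietro 2008 (14.67) p. 223 [cite: Mastropietro2008].
-/

noncomputable section

namespace Summit.HubbardSuperconductivity.HubbardSuperconductivity.Theorems.PerturbedFermiCurve

set_option linter.dupNamespace false -- summit = problem name (single-conjunct summit), D-0017

open Real Set
open Literature.MathematicalPhysics.QuantumLattice Literature.MathematicalPhysics.QuantumLattice.BandSectorCounting

/-- From `sin` and `cos` both close, the angles agree modulo `2π`: if `|sin A − sin B| ≤ e`, `|cos A − cos B| ≤ e`, `e < 1/2`, then
`A − B = 2πm + d` with `|d| ≤ π·e` (private plumbing; the band file's private lemma). [folklore] -/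
private theorem exists_int_near_of_sin_cos_close' {A B e : ℝ} (hs : |Real.sin A - Real.sin B| ≤ e) (hc : |Real.cos A - Real.cos B| ≤ e)
    (he : e < 1 / 2) : ∃ m : ℤ, |A - B - m * (2 * π)| ≤ π * e := by
  have hπ := Real.pi_pos
  have he0 : 0 ≤ e := (abs_nonneg _).trans hs
  obtain ⟨m, hm⟩ := exists_int_abs_sub_le_pi (A - B)
  set d := A - B - m * (2 * π) with hd
  refine ⟨m, ?_⟩
  have hsd : Real.sin d = Real.sin A * Real.cos B - Real.cos A * Real.sin B := by
    rw [hd, Real.sin_sub_int_mul_two_pi, Real.sin_sub]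
  have hcd : Real.cos d = Real.cos A * Real.cos B + Real.sin A * Real.sin B := by
    rw [hd, Real.cos_sub_int_mul_two_pi, Real.cos_sub]
  have hB := Real.sin_sq_add_cos_sq B
  have hsin : |Real.sin d| ≤ 2 * e := by
    have e1 : Real.sin d = (Real.sin A - Real.sin B) * Real.cos B - (Real.cos A - Real.cos B) * Real.sin B := by rw [hsd]; ring
    rw [e1]
    have b1 : |(Real.sin A - Real.sin B) * Real.cos B| ≤ e * 1 := by
      rw [abs_mul]; exact mul_le_mul hs (Real.abs_cos_le_one _) (abs_nonneg _) he0
    have b2 : |(Real.cos A - Real.cos B) * Real.sin B| ≤ e * 1 := by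
      rw [abs_mul]; exact mul_le_mul hc (Real.abs_sin_le_one _) (abs_nonneg _) he0
    have := abs_sub ((Real.sin A - Real.sin B) * Real.cos B) ((Real.cos A - Real.cos B) * Real.sin B)
    linarith
  have hcos : 0 < Real.cos d := by
    have e1 : Real.cos d = 1 + ((Real.cos A - Real.cos B) * Real.cos B + (Real.sin A - Real.sin B) * Real.sin B) := by
      rw [hcd]; nlinarith [hB]
    have b1 : |(Real.cos A - Real.cos B) * Real.cos B| ≤ e * 1 := by
      rw [abs_mul]; exact mul_le_mul hc (Real.abs_cos_le_one _) (abs_nonneg _) he0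
    have b2 : |(Real.sin A - Real.sin B) * Real.sin B| ≤ e * 1 := by
      rw [abs_mul]; exact mul_le_mul hs (Real.abs_sin_le_one _) (abs_nonneg _) he0
    have := neg_abs_le ((Real.cos A - Real.cos B) * Real.cos B)
    have := neg_abs_le ((Real.sin A - Real.sin B) * Real.sin B)
    rw [e1]; linarith
  rcases near_zero_or_pi_of_abs_sin_le hm hsin with h | h
  · linarith
  · exfalso
    have hlt : π - |d| < π / 2 := by nlinarith
    have h0 : 0 ≤ π - |d| := by linarith [hm]
    have hcpos : 0 < Real.cos (π - |d|) := Real.cos_pos_of_mem_Ioo ⟨by linarith, hlt⟩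
    rw [Real.cos_pi_sub, Real.cos_abs] at hcpos
    linarith

section Aligned

variable {a b : ℝ} (B : BandBounds a b) {δ : (Fin 2 → ℝ) → ℝ} (hδs : ContDiff ℝ 2 δ)
  {κ₀ κ₁ κ₂ μ : ℝ} (hδ : ∀ k : Fin 2 → ℝ, |δ k| ≤ κ₀) (hlo : a ≤ μ - κ₀) (hhi : μ + κ₀ ≤ b)
  (hκ : ∀ k : Fin 2 → ℝ, ‖fderiv ℝ δ k‖ ≤ κ₁) (hκ₁ : κ₁ < B.Dtmin)
  {u : ℝ → ℝ} (hu : ∀ θ, IsBandFermiRadius (μ - δ (u θ • dir θ)) θ (u θ))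

include B hδ hlo hhi hu in
/-- **Chord bound on the perturbed curve**: `4 u_min² sin²((θ − θ′)/2) ≤ (X_E θ − X_E θ′)² + (Y_E θ − Y_E θ′)²` (polar curve with radius
`≥ u_min`). [folklore] -/
theorem chord_lower_perturbed (θ θ' : ℝ) :
    4 * B.umin ^ 2 * Real.sin ((θ - θ') / 2) ^ 2 ≤ (XE u θ - XE u θ') ^ 2 + (YE u θ - YE u θ') ^ 2 := by
  have hδ' : ∀ k : Fin 2 → ℝ, (∀ i, |k i| ≤ π) → |δ k| ≤ κ₀ := fun k _ => hδ k
  have hu1 : B.umin ≤ u θ := umin_le_of_shifted B hδ' hlo hhi (hu θ)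
  have hu2 : B.umin ≤ u θ' := umin_le_of_shifted B hδ' hlo hhi (hu θ')
  have hup := B.umin_pos
  have hcos : Real.cos (θ - θ') = 1 - 2 * Real.sin ((θ - θ') / 2) ^ 2 := by
    have := Real.cos_two_mul_eq_one_sub ((θ - θ') / 2)
    rwa [show 2 * ((θ - θ') / 2) = θ - θ' by ring] at this
  have hid : (XE u θ - XE u θ') ^ 2 + (YE u θ - YE u θ') ^ 2 =
      (u θ - u θ') ^ 2 + 4 * (u θ * u θ') * Real.sin ((θ - θ') / 2) ^ 2 := by
    simp only [XE, YE]
    have h3 := Real.cos_sub θ θ'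
    have e1 := Real.sin_sq_add_cos_sq θ; have e2 := Real.sin_sq_add_cos_sq θ'
    linear_combination (u θ) ^ 2 * e1 + (u θ') ^ 2 * e2 + 2 * u θ * u θ' * h3 - 2 * u θ * u θ' * hcos
  rw [hid]
  have hs2 : 0 ≤ Real.sin ((θ - θ') / 2) ^ 2 := sq_nonneg _
  have hprod : B.umin ^ 2 ≤ u θ * u θ' := by
    rw [sq]; exact mul_le_mul hu1 hu2 hup.le (hup.le.trans hu1)
  nlinarith [sq_nonneg (u θ - u θ')]

include B hδ hlo hhi hu in
/-- **The perturbed curve lies in the coordinate square of radius `K(b)`**: `|X_E θ| ≤ K(b)` and `|Y_E θ| ≤ K(b)` (`X_E θ = bandX ν θ` at the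
shifted level `ν ≤ b`, `|bandX ν| ≤ K(ν) ≤ K(b)`). [cite: BenfattoGiulianiMastropietro2006, Remark after (2.39)] -/
theorem abs_XE_le_umklappRadius (θ : ℝ) : |XE u θ| ≤ umklappRadius b ∧ |YE u θ| ≤ umklappRadius b := by
  have hδ' : ∀ k : Fin 2 → ℝ, (∀ i, |k i| ≤ π) → |δ k| ≤ κ₀ := fun k _ => hδ k
  have hm := shiftedLevel_mem_Icc (hu θ) hδ' hlo hhi
  obtain ⟨hX, hY⟩ := XE_eq_bandX_shifted B hδ' hlo hhi hu θ
  obtain ⟨h1, h2⟩ := B.level hm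
  rw [hX, hY]
  exact ⟨(abs_bandX_le_umklappRadius h1 h2 θ).trans (umklappRadius_mono hm.2),
    (abs_bandY_le_umklappRadius h1 h2 θ).trans (umklappRadius_mono hm.2)⟩

include B hδs hδ hlo hhi hκ hκ₁ hu

/-- The common first half of the dichotomy and of the rigidity: from `|h^E_P(σ,σ)| ≤ η₀` and `|∂₃h^E_P(σ,σ)| ≤ η₁` there is a sign `s = ±1`
with `|s·sin S_x − sin X_E(σ)|, |s·sin S_y − sin Y_E(σ)|, |cos S_x − cos X_E(σ)|, |cos S_y − cos Y_E(σ)| ≤ e₃`. [cite: BenfattoGiulianiMastropietro2006, App. A2] -/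
theorem exists_sign_trig_close_perturbed {P : ℝ × ℝ} {σ η₀ η₁ : ℝ} (hlo' : a ≤ μ - κ₀ - η₀) (hhi' : μ + κ₀ + η₀ ≤ b)
    (hH : |hfunE δ u μ P σ σ| ≤ η₀) (hH' : |h3E δ u P σ σ| ≤ η₁) :
    ∃ s : ℝ, (s = 1 ∨ s = -1) ∧
      |s * Real.sin (SXE u P σ σ) - Real.sin (XE u σ)| ≤ η₀ / B.Dtmin + 2 * κ₀ / B.Dtmin + B.smax * (B.Cg * pcE4 B κ₀ κ₁ η₁ η₀) ∧
      |s * Real.sin (SYE u P σ σ) - Real.sin (YE u σ)| ≤ η₀ / B.Dtmin + 2 * κ₀ / B.Dtmin + B.smax * (B.Cg * pcE4 B κ₀ κ₁ η₁ η₀) ∧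
      |Real.cos (SXE u P σ σ) - Real.cos (XE u σ)| ≤ η₀ / B.Dtmin + 2 * κ₀ / B.Dtmin + B.smax * (B.Cg * pcE4 B κ₀ κ₁ η₁ η₀) ∧
      |Real.cos (SYE u P σ σ) - Real.cos (YE u σ)| ≤ η₀ / B.Dtmin + 2 * κ₀ / B.Dtmin + B.smax * (B.Cg * pcE4 B κ₀ κ₁ η₁ η₀) := by
  have h2ne : (2 : WithTop ℕ∞) ≠ 0 := by norm_num
  have hδ' : ∀ k : Fin 2 → ℝ, (∀ i, |k i| ≤ π) → |δ k| ≤ κ₀ := fun k _ => hδ k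
  have hDt := B.Dtmin_pos; have hsm := B.smax_pos; have hCg := B.Cg_pos
  set Sx := SXE u P σ σ with hSx
  set Sy := SYE u P σ σ with hSy
  set S := momE u P σ σ with hS
  set μ' := μ - δ S with hμ'def
  have hz := abs_le.1 (hδ S)
  have hη₀ : 0 ≤ η₀ := (abs_nonneg _).trans hH
  have hμ' : μ' ∈ Icc a b := ⟨by linarith [hz.2], by linarith [hz.1]⟩
  have hlo'' : a ≤ μ' - η₀ := by linarith [hz.2]
  have hhi'' : μ' + η₀ ≤ b := by linarith [hz.1]
  have hh' : |eps2 Sx Sy - μ'| ≤ η₀ := by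
    have : eps2 Sx Sy - μ' = hfunE δ u μ P σ σ := by rw [hμ'def, hS, hSx, hSy, hfunE]; ring
    rw [this]; exact hH
  have hgap : |μ' - (μ - δ (u σ • dir σ))| ≤ 2 * κ₀ := by
    have h1 := abs_le.1 (hδ (u σ • dir σ)); rw [hμ'def, abs_le]; constructor <;> linarith [hz.1, hz.2]
  -- step 1: a free curve point of level `μ'` with the trigonometric data of `S`
  obtain ⟨φ, hsx, hsy, hcx, hcy⟩ := exists_near_curve_trig B hμ' hh' hlo'' hhi''
  -- step 2: `φ ≡ σ (mod π)` from the smallness of the perturbed diagonal partial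
  have hmid : |2 * Real.sin Sx * VXE u σ + 2 * Real.sin Sy * VYE u σ + fderiv ℝ δ S ![VXE u σ, VYE u σ]| ≤ η₁ := by
    have : 2 * Real.sin Sx * VXE u σ + 2 * Real.sin Sy * VYE u σ + fderiv ℝ δ S ![VXE u σ, VYE u σ] = h3E δ u P σ σ := by
      rw [hS, hSx, hSy]; rfl
    rw [this]; exact hH'
  obtain ⟨j, hj⟩ := exists_int_near_of_h3E_small B hδs h2ne hδ hlo hhi hκ hκ₁ hu hμ' hsx hsy σ hgap hmid
  have hjE : |φ - σ - j * π| ≤ B.Cg * pcE4 B κ₀ κ₁ η₁ η₀ := by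
    refine hj.trans (le_of_eq ?_)
    simp only [pcE4, pcSE, pcCV]
  -- step 3: sign alignment at the shifted level of the leg `σ`
  set ν := μ - δ (u σ • dir σ) with hν
  have hνmem : ν ∈ Icc a b := shiftedLevel_mem_Icc (hu σ) hδ' hlo hhi
  obtain ⟨s, hs, ax, ay, cx, cy⟩ := exists_sign_align B hνmem hjE
  have hsabs : |s| = 1 := by rcases hs with rfl | rfl <;> norm_num
  obtain ⟨hXσ, hYσ⟩ := XE_eq_bandX_shifted B hδ' hlo hhi hu σ
  -- the level shift `μ' → ν` at the angle `φ`
  have hradφ : |bandFermiRadius μ' φ - bandFermiRadius ν φ| ≤ 2 * κ₀ / B.Dtmin :=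
    (abs_bandFermiRadius_sub_le_of_level B hνmem hμ' φ).trans (div_le_div_of_nonneg_right hgap hDt.le)
  have s2x : |Real.sin (bandX μ' φ) - Real.sin (bandX ν φ)| ≤ 2 * κ₀ / B.Dtmin := by
    refine (Real.abs_sin_sub_sin_le _ _).trans ?_
    rw [bandX, bandX, ← sub_mul, abs_mul]
    exact (mul_le_of_le_one_right (abs_nonneg _) (Real.abs_cos_le_one φ)).trans hradφ
  have s2y : |Real.sin (bandY μ' φ) - Real.sin (bandY ν φ)| ≤ 2 * κ₀ / B.Dtmin := by
    refine (Real.abs_sin_sub_sin_le _ _).trans ?_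
    rw [bandY, bandY, ← sub_mul, abs_mul]
    exact (mul_le_of_le_one_right (abs_nonneg _) (Real.abs_sin_le_one φ)).trans hradφ
  have c2x : |Real.cos (bandX μ' φ) - Real.cos (bandX ν φ)| ≤ 2 * κ₀ / B.Dtmin := by
    refine (Real.abs_cos_sub_cos_le _ _).trans ?_
    rw [bandX, bandX, ← sub_mul, abs_mul]
    exact (mul_le_of_le_one_right (abs_nonneg _) (Real.abs_cos_le_one φ)).trans hradφ
  have c2y : |Real.cos (bandY μ' φ) - Real.cos (bandY ν φ)| ≤ 2 * κ₀ / B.Dtmin := by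
    refine (Real.abs_cos_sub_cos_le _ _).trans ?_
    rw [bandY, bandY, ← sub_mul, abs_mul]
    exact (mul_le_of_le_one_right (abs_nonneg _) (Real.abs_sin_le_one φ)).trans hradφ
  refine ⟨s, hs, ?_, ?_, ?_, ?_⟩
  · rw [hXσ]
    have e : s * Real.sin Sx - Real.sin (bandX ν σ) =
        s * ((Real.sin Sx - Real.sin (bandX μ' φ)) + (Real.sin (bandX μ' φ) - Real.sin (bandX ν φ))) +
          (s * Real.sin (bandX ν φ) - Real.sin (bandX ν σ)) := by ring
    rw [e]
    refine (abs_add_le _ _).trans ?_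
    rw [abs_mul, hsabs, one_mul]
    have := abs_add_le (Real.sin Sx - Real.sin (bandX μ' φ)) (Real.sin (bandX μ' φ) - Real.sin (bandX ν φ))
    linarith
  · rw [hYσ]
    have e : s * Real.sin Sy - Real.sin (bandY ν σ) =
        s * ((Real.sin Sy - Real.sin (bandY μ' φ)) + (Real.sin (bandY μ' φ) - Real.sin (bandY ν φ))) +
          (s * Real.sin (bandY ν φ) - Real.sin (bandY ν σ)) := by ring
    rw [e]
    refine (abs_add_le _ _).trans ?_
    rw [abs_mul, hsabs, one_mul]
    have := abs_add_le (Real.sin Sy - Real.sin (bandY μ' φ)) (Real.sin (bandY μ' φ) - Real.sin (bandY ν φ))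
    linarith
  · rw [hXσ]
    have e : Real.cos Sx - Real.cos (bandX ν σ) =
        ((Real.cos Sx - Real.cos (bandX μ' φ)) + (Real.cos (bandX μ' φ) - Real.cos (bandX ν φ))) +
          (Real.cos (bandX ν φ) - Real.cos (bandX ν σ)) := by ring
    rw [e]
    refine (abs_add_le _ _).trans ?_
    have := abs_add_le (Real.cos Sx - Real.cos (bandX μ' φ)) (Real.cos (bandX μ' φ) - Real.cos (bandX ν φ))
    linarith
  · rw [hYσ]
    have e : Real.cos Sy - Real.cos (bandY ν σ) =
        ((Real.cos Sy - Real.cos (bandY μ' φ)) + (Real.cos (bandY μ' φ) - Real.cos (bandY ν φ))) +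
          (Real.cos (bandY ν φ) - Real.cos (bandY ν σ)) := by ring
    rw [e]
    refine (abs_add_le _ _).trans ?_
    have := abs_add_le (Real.cos Sy - Real.cos (bandY μ' φ)) (Real.cos (bandY μ' φ) - Real.cos (bandY ν φ))
    linarith

/-- **Alignment dichotomy on the perturbed curve.**  For any offset `P`: if `|h^E_P(σ,σ)| ≤ η₀` and `|∂₃h^E_P(σ,σ)| ≤ η₁` then
`ρ_min² − 2e₃ ≤ |sin S_x·sin X_E(σ) + sin S_y·sin Y_E(σ)|`, `e₃ = η₀/Dt_min + 2κ₀/Dt_min + s_max·C_g·ε₄(η₁)` — the near-critical near-zero rows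
of the thin fold count are aligned or anti-aligned with margin. [cite: BenfattoGiulianiMastropietro2006, App. A2] -/
theorem abs_alignment_ge_perturbed {P : ℝ × ℝ} {σ η₀ η₁ : ℝ} (hlo' : a ≤ μ - κ₀ - η₀) (hhi' : μ + κ₀ + η₀ ≤ b)
    (hH : |hfunE δ u μ P σ σ| ≤ η₀) (hH' : |h3E δ u P σ σ| ≤ η₁) :
    B.rhomin ^ 2 - 2 * (η₀ / B.Dtmin + 2 * κ₀ / B.Dtmin + B.smax * (B.Cg * pcE4 B κ₀ κ₁ η₁ η₀)) ≤
      |Real.sin (SXE u P σ σ) * Real.sin (XE u σ) + Real.sin (SYE u P σ σ) * Real.sin (YE u σ)| := by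
  have hδ' : ∀ k : Fin 2 → ℝ, (∀ i, |k i| ≤ π) → |δ k| ≤ κ₀ := fun k _ => hδ k
  obtain ⟨s, hs, dX, dY, -, -⟩ := exists_sign_trig_close_perturbed B hδs hδ hlo hhi hκ hκ₁ hu hlo' hhi' hH hH'
  set e₃ := η₀ / B.Dtmin + 2 * κ₀ / B.Dtmin + B.smax * (B.Cg * pcE4 B κ₀ κ₁ η₁ η₀) with he₃
  have hsabs : |s| = 1 := by rcases hs with rfl | rfl <;> norm_num
  set Sx := SXE u P σ σ
  set Sy := SYE u P σ σ
  -- `ρ_min² ≤ sin² X_E + sin² Y_E` at the shifted level of `σ`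
  have hνmem : μ - δ (u σ • dir σ) ∈ Icc a b := shiftedLevel_mem_Icc (hu σ) hδ' hlo hhi
  obtain ⟨hXσ, hYσ⟩ := XE_eq_bandX_shifted B hδ' hlo hhi hu σ
  have hρσ : B.rhomin ^ 2 ≤ Real.sin (XE u σ) ^ 2 + Real.sin (YE u σ) ^ 2 := by
    rw [hXσ, hYσ]
    have h0 := B.rho_ge _ hνmem σ
    have hρ0 := B.rhomin_pos
    calc B.rhomin ^ 2 ≤ (Real.sqrt (Real.sin (bandX (μ - δ (u σ • dir σ)) σ) ^ 2 + Real.sin (bandY (μ - δ (u σ • dir σ)) σ) ^ 2)) ^ 2 := by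
          gcongr
      _ = _ := Real.sq_sqrt (by positivity)
  have e : s * (Real.sin Sx * Real.sin (XE u σ) + Real.sin Sy * Real.sin (YE u σ)) =
      Real.sin (XE u σ) ^ 2 + Real.sin (YE u σ) ^ 2 +
      ((s * Real.sin Sx - Real.sin (XE u σ)) * Real.sin (XE u σ) + (s * Real.sin Sy - Real.sin (YE u σ)) * Real.sin (YE u σ)) := by ring
  have bnd := abs_two_term_le dX (Real.abs_sin_le_one (XE u σ)) dY (Real.abs_sin_le_one (YE u σ))
  have bnd' := neg_abs_le ((s * Real.sin Sx - Real.sin (XE u σ)) * Real.sin (XE u σ) +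
        (s * Real.sin Sy - Real.sin (YE u σ)) * Real.sin (YE u σ))
  have hlow : B.rhomin ^ 2 - 2 * e₃ ≤ s * (Real.sin Sx * Real.sin (XE u σ) + Real.sin Sy * Real.sin (YE u σ)) := by
    rw [e]; linarith
  have habs : |s * (Real.sin Sx * Real.sin (XE u σ) + Real.sin Sy * Real.sin (YE u σ))| =
      |Real.sin Sx * Real.sin (XE u σ) + Real.sin Sy * Real.sin (YE u σ)| := by rw [abs_mul, hsabs, one_mul]
  rw [← habs]
  exact hlow.trans (le_abs_self _)

/-- **Aligned rigidity on the perturbed curve (even `δ`).**  With the anchor offset ON the curve, `P = p_E(θ₁)`: if `|h^E_P(σ,σ)| ≤ η₀`,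
`|∂₃h^E_P(σ,σ)| ≤ η₁` and the row is ALIGNED, `0 < sin S_x·sin X_E(σ) + sin S_y·sin Y_E(σ)`, then — with `e₃ = η₀/Dt_min + 2κ₀/Dt_min +
s_max·C_g·ε₄(η₁)`, provided `2e₃ < ρ_min²`, `e₃ < 1/2` and the umklapp margin `π e₃ + 2K(b) < 2π` — `σ` is the forward point up to `O(e₃)`:
`|sin((σ − θ₁ − π)/2)| ≤ π·e₃/(√2·u_min)`. [cite: BenfattoGiulianiMastropietro2006, App. A2] -/
theorem aligned_rigidity_perturbed (heven : ∀ k, δ (-k) = δ k) {θ₁ σ η₀ η₁ : ℝ} (hlo' : a ≤ μ - κ₀ - η₀) (hhi' : μ + κ₀ + η₀ ≤ b)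
    (hH : |hfunE δ u μ (XE u θ₁, YE u θ₁) σ σ| ≤ η₀) (hH' : |h3E δ u (XE u θ₁, YE u θ₁) σ σ| ≤ η₁)
    (hI : 0 < Real.sin (SXE u (XE u θ₁, YE u θ₁) σ σ) * Real.sin (XE u σ) + Real.sin (SYE u (XE u θ₁, YE u θ₁) σ σ) * Real.sin (YE u σ))
    (hρ : 2 * (η₀ / B.Dtmin + 2 * κ₀ / B.Dtmin + B.smax * (B.Cg * pcE4 B κ₀ κ₁ η₁ η₀)) < B.rhomin ^ 2)
    (hhalf : η₀ / B.Dtmin + 2 * κ₀ / B.Dtmin + B.smax * (B.Cg * pcE4 B κ₀ κ₁ η₁ η₀) < 1 / 2)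
    (hmargin : π * (η₀ / B.Dtmin + 2 * κ₀ / B.Dtmin + B.smax * (B.Cg * pcE4 B κ₀ κ₁ η₁ η₀)) + 2 * umklappRadius b < 2 * π) :
    |Real.sin ((σ - θ₁ - π) / 2)| ≤
      π * (η₀ / B.Dtmin + 2 * κ₀ / B.Dtmin + B.smax * (B.Cg * pcE4 B κ₀ κ₁ η₁ η₀)) / (Real.sqrt 2 * B.umin) := by
  have h2ne : (2 : WithTop ℕ∞) ≠ 0 := by norm_num
  have hδ' : ∀ k : Fin 2 → ℝ, (∀ i, |k i| ≤ π) → |δ k| ≤ κ₀ := fun k _ => hδ k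
  have hκ' : ∀ k : Fin 2 → ℝ, (∀ i, |k i| ≤ π) → ‖fderiv ℝ δ k‖ ≤ κ₁ := fun k _ => hκ k
  have hd' : ∀ k : Fin 2 → ℝ, (∀ i, |k i| ≤ π) → DifferentiableAt ℝ δ k := fun k _ => (hδs.differentiable h2ne) k
  have hπ := Real.pi_pos; have hu0 := B.umin_pos
  set P : ℝ × ℝ := (XE u θ₁, YE u θ₁) with hP
  obtain ⟨s, hs, dX, dY, cX, cY⟩ := exists_sign_trig_close_perturbed B hδs hδ hlo hhi hκ hκ₁ hu hlo' hhi' hH hH'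
  set e₃ := η₀ / B.Dtmin + 2 * κ₀ / B.Dtmin + B.smax * (B.Cg * pcE4 B κ₀ κ₁ η₁ η₀) with he₃
  have hsabs : |s| = 1 := by rcases hs with rfl | rfl <;> norm_num
  set Sx := SXE u P σ σ with hSx
  set Sy := SYE u P σ σ with hSy
  have he₃0 : 0 ≤ e₃ := (abs_nonneg _).trans cX
  -- the alignment forces `s = 1`
  have hνmem : μ - δ (u σ • dir σ) ∈ Icc a b := shiftedLevel_mem_Icc (hu σ) hδ' hlo hhi
  obtain ⟨hXσ, hYσ⟩ := XE_eq_bandX_shifted B hδ' hlo hhi hu σ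
  have hρσ : B.rhomin ^ 2 ≤ Real.sin (XE u σ) ^ 2 + Real.sin (YE u σ) ^ 2 := by
    rw [hXσ, hYσ]
    have h0 := B.rho_ge _ hνmem σ
    have hρ0 := B.rhomin_pos
    calc B.rhomin ^ 2 ≤ (Real.sqrt (Real.sin (bandX (μ - δ (u σ • dir σ)) σ) ^ 2 + Real.sin (bandY (μ - δ (u σ • dir σ)) σ) ^ 2)) ^ 2 := by
          gcongr
      _ = _ := Real.sq_sqrt (by positivity)
  have hs1 : s = 1 := by
    rcases hs with hs | hs
    · exact hs
    · exfalso
      have e : s * (Real.sin Sx * Real.sin (XE u σ) + Real.sin Sy * Real.sin (YE u σ)) =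
          Real.sin (XE u σ) ^ 2 + Real.sin (YE u σ) ^ 2 +
          ((s * Real.sin Sx - Real.sin (XE u σ)) * Real.sin (XE u σ) + (s * Real.sin Sy - Real.sin (YE u σ)) * Real.sin (YE u σ)) := by ring
      have bnd := abs_two_term_le dX (Real.abs_sin_le_one (XE u σ)) dY (Real.abs_sin_le_one (YE u σ))
      have bnd' := neg_abs_le ((s * Real.sin Sx - Real.sin (XE u σ)) * Real.sin (XE u σ) +
            (s * Real.sin Sy - Real.sin (YE u σ)) * Real.sin (YE u σ))
      have hpos : 0 < s * (Real.sin Sx * Real.sin (XE u σ) + Real.sin Sy * Real.sin (YE u σ)) := by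
        rw [e]; rw [he₃] at hρ; linarith
      rw [hs] at hpos
      linarith
  rw [hs1, one_mul] at dX dY
  -- `Sx ≡ X_E σ`, `Sy ≡ Y_E σ (mod 2π)` up to `πe₃`; the integers vanish by the umklapp margin
  have hhalf' : e₃ < 1 / 2 := hhalf
  obtain ⟨m₀, hm₀⟩ := exists_int_near_of_sin_cos_close' dX cX hhalf'
  obtain ⟨m₁, hm₁⟩ := exists_int_near_of_sin_cos_close' dY cY hhalf'
  have eSx : Sx - XE u σ = XE u θ₁ + XE u σ := by rw [hSx]; unfold SXE; ring
  have eSy : Sy - YE u σ = YE u θ₁ + YE u σ := by rw [hSy]; unfold SYE; ring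
  rw [eSx] at hm₀; rw [eSy] at hm₁
  obtain ⟨hK1, hK3⟩ := abs_XE_le_umklappRadius B hδ hlo hhi hu θ₁
  obtain ⟨hK2, hK4⟩ := abs_XE_le_umklappRadius B hδ hlo hhi hu σ
  have hmarg : π * e₃ + 2 * umklappRadius b < 2 * π := hmargin
  have int_zero : ∀ (m : ℤ) (U V : ℝ), |U| ≤ umklappRadius b → |V| ≤ umklappRadius b → |U + V - m * (2 * π)| ≤ π * e₃ → m = 0 := by
    intro m U V hU hV hm
    by_contra hne
    have h1m : (1 : ℝ) ≤ |(m : ℝ)| := by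
      rw [← Int.cast_abs]; exact_mod_cast Int.one_le_abs hne
    have hbig : 2 * π ≤ |(m : ℝ) * (2 * π)| := by
      rw [abs_mul, abs_of_pos (by positivity : (0:ℝ) < 2 * π)]
      calc 2 * π = 1 * (2 * π) := by ring
        _ ≤ |(m : ℝ)| * (2 * π) := mul_le_mul_of_nonneg_right h1m (by positivity)
    have htri : |(m : ℝ) * (2 * π)| ≤ |U + V| + |U + V - m * (2 * π)| := by
      have h0 := abs_sub_abs_le_abs_sub ((m : ℝ) * (2 * π)) (U + V)
      rw [abs_sub_comm] at h0; linarith only [h0]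
    have hUV : |U + V| ≤ 2 * umklappRadius b := (abs_add_le U V).trans (by linarith only [hU, hV])
    linarith only [hbig, htri, hUV, hm, hmarg]
  have hm₀0 := int_zero m₀ _ _ hK1 hK2 hm₀
  have hm₁0 := int_zero m₁ _ _ hK3 hK4 hm₁
  rw [hm₀0] at hm₀; rw [hm₁0] at hm₁
  simp only [Int.cast_zero, zero_mul, sub_zero] at hm₀ hm₁
  -- `p_E(σ) ≈ −p_E(θ₁) = p_E(θ₁ + π)` and the chord bound
  obtain ⟨px, py, -, -⟩ := curve_add_pi B hδ' hlo hhi hd' hκ' hκ₁ hu heven θ₁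
  have hch := chord_lower_perturbed B hδ hlo hhi hu σ (θ₁ + π)
  rw [px, py, sub_neg_eq_add, sub_neg_eq_add, add_comm (XE u σ), add_comm (YE u σ)] at hch
  have hsq : (XE u θ₁ + XE u σ) ^ 2 + (YE u θ₁ + YE u σ) ^ 2 ≤ 2 * (π * e₃) ^ 2 := by
    have a1 : (XE u θ₁ + XE u σ) ^ 2 ≤ (π * e₃) ^ 2 := by
      rw [← sq_abs (XE u θ₁ + XE u σ)]
      exact pow_le_pow_left₀ (abs_nonneg _) hm₀ 2
    have a2 : (YE u θ₁ + YE u σ) ^ 2 ≤ (π * e₃) ^ 2 := by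
      rw [← sq_abs (YE u θ₁ + YE u σ)]
      exact pow_le_pow_left₀ (abs_nonneg _) hm₁ 2
    linarith only [a1, a2]
  have hang : (σ - (θ₁ + π)) / 2 = (σ - θ₁ - π) / 2 := by ring
  rw [hang] at hch
  have hs2 : Real.sin ((σ - θ₁ - π) / 2) ^ 2 ≤ (π * e₃ / (Real.sqrt 2 * B.umin)) ^ 2 := by
    have h2 : (Real.sqrt 2) ^ 2 = 2 := Real.sq_sqrt (by norm_num)
    rw [div_pow, mul_pow, mul_pow, h2]
    rw [le_div_iff₀ (by positivity)]
    have hu2 : 0 < B.umin ^ 2 := by positivity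
    nlinarith only [hch, hsq, hu2]
  have := Real.sqrt_le_sqrt hs2
  rw [Real.sqrt_sq_eq_abs, Real.sqrt_sq (by positivity)] at this
  exact this

end Aligned

end Summit.HubbardSuperconductivity.HubbardSuperconductivity.Theorems.PerturbedFermiCurve

end
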